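import Summits.RiemannHypothesis.RiemannHypothesis.Theorems.JensenPolynomialsFarGumbelJunkSplit
import Summits.RiemannHypothesis.RiemannHypothesis.Theorems.JensenPolynomialsTruncatedBinomialGeom
import Literature.NumberTheory.LFunctions.DeBruijnPhiLogDerivEnvelope
import Literature.NumberTheory.LFunctions.DeBruijnPhiDecreasing

/-!
# Route `JensenPolynomials`, FAR crux `XiWindowZeroFreeRelFar` (B1-rel far) — line «far-gumbel», stub S2 `stub_junk`, part B2:
the POINTWISE bound in the band `0.4υ ≤ u ≤ υ` (RH-FREE; cell rh-jensen, HUMAN RULING D-0040; helper for item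
`stmt-RiemannHypothesis-19465`)

In the band the truncated binomial series `T_M(a/u²)` carries BOTH branches (`|w| = |a|/u² ∈ [0.35, 2.2]`): the two-branch bound
with the geometric segment term (`WindowEGF.norm_truncBinom_sub_cpow_le_geom`) and the `√`-majorant of the arc integral give

  `Φu^{2M}‖T_M(a/u²)‖ ≤ 50e^{9υ}υ^{2M}‖1+a/υ²‖^N·((u²/υ² + 0.3502)/1.3502)^N + 0.225‖a‖^{M+1}u^{−2}
     + 0.71·‖a‖^M‖a‖^{3/4}·u^{−1}|u − √‖a‖|^{−1/2}`   (`N = M − ½`, `u² ≠ ‖a‖`)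

(`junk_pointwise_R2`): bulk via `‖x + z‖ ≤ ‖1+z‖(x+r₀)/(1+r₀)`, segment `u|u²+a|^N·½C·r(r/(1+r))^M ≤ ½C‖a‖^{M+1}u^{−2}`,
endpoint `½C‖a‖^{M+1}u^{−2}·π/√(|1−r|√r)` with `|1−r|√r ≥ |u−√‖a‖|·‖a‖^{1/2}/u²`.

WHAT THIS IS NOT: elementary real inequalities; nothing here bears on the zeros of `ζ` or the truth of RH.
References: [GORZPNAS2019]; Szegő 1924.
-/

noncomputable section
-- D-0017: `Summit.RiemannHypothesis.RiemannHypothesis.…` duplicates the namespace BY DESIGN (single-problem summit).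
set_option linter.dupNamespace false

namespace Summit.RiemannHypothesis.RiemannHypothesis.Theorems.JensenPolynomials.FarGumbel

open Literature.NumberTheory.LFunctions MeasureTheory Set Complex Real
open Summit.RiemannHypothesis.RiemannHypothesis.Theorems.JensenPolynomials.WindowEGF

/-! ## 0. Two local copies (of `…JunkPointwise` §1–2, kept private so that this file does not import that module) -/

/-- `Φ ≤ 0.45` everywhere (local copy of `…JunkPointwise`’s `deBruijnPhi_le_045`). -/
private theorem deBruijnPhi_le_045_loc (u : ℝ) : deBruijnPhi u ≤ 0.45 :=
  (deBruijnPhi_le_deBruijnPhi_zero u).trans deBruijnPhi_zero_le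

/-- For `r₀² ≤ x ≤ 1`, `‖z‖ ≤ r₀`: `‖x + z‖ ≤ ‖1 + z‖·(x + r₀)/(1 + r₀)` (local copy of `…JunkPointwise`’s `norm_real_add_le_ratio`). -/
private theorem norm_real_add_le_ratio_loc {x r₀ : ℝ} (hr0 : 0 ≤ r₀) (hx0 : r₀ ^ 2 ≤ x) (hx1 : x ≤ 1) {z : ℂ}
    (hz : ‖z‖ ≤ r₀) : ‖(x : ℂ) + z‖ ≤ ‖1 + z‖ * ((x + r₀) / (1 + r₀)) := by
  have hre : |z.re| ≤ ‖z‖ := Complex.abs_re_le_norm z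
  have hc1 : z.re ≤ r₀ := ((le_abs_self _).trans hre).trans hz
  have hq : z.re ^ 2 + z.im ^ 2 ≤ r₀ ^ 2 := by
    have h := Complex.sq_norm z
    rw [Complex.normSq_apply] at h
    nlinarith [norm_nonneg z]
  have h1r : 0 < 1 + r₀ := by linarith
  have hxr : 0 ≤ x + r₀ := by nlinarith
  have hsq : (‖(x : ℂ) + z‖ * (1 + r₀)) ^ 2 ≤ (‖1 + z‖ * (x + r₀)) ^ 2 := by
    rw [mul_pow, mul_pow, Complex.sq_norm, Complex.sq_norm, Complex.normSq_apply, Complex.normSq_apply]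
    simp only [Complex.add_re, Complex.add_im, Complex.ofReal_re, Complex.ofReal_im, Complex.one_re, Complex.one_im,
      zero_add]
    have h1x : 0 ≤ 1 - x := by linarith
    have hxr2 : 0 ≤ x - r₀ ^ 2 := by linarith
    nlinarith [mul_nonneg h1x hxr2, mul_nonneg h1x hr0, mul_le_mul_of_nonneg_left hc1 hxr2,
      mul_le_mul_of_nonneg_left hq (by linarith : (0:ℝ) ≤ 1 + x + 2 * r₀), mul_nonneg h1x (mul_nonneg hr0 hxr)]
  have hlhs : 0 ≤ ‖(x : ℂ) + z‖ * (1 + r₀) := by positivity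
  have hrhs : 0 ≤ ‖1 + z‖ * (x + r₀) := by positivity
  have h := (pow_le_pow_iff_left₀ hlhs hrhs two_ne_zero).mp hsq
  rw [mul_div_assoc', le_div_iff₀ h1r]
  exact h

/-! ## 4. Region R2: `0.4υ ≤ u ≤ υ` — two-branch bound with the geometric segment term -/

/-- `binom(M−½, M) ≤ 1`. -/
theorem halfBinom_top_le_one (M : ℕ) :
    ((descPochhammer ℝ M).eval ((M : ℝ) - 1 / 2) / (Nat.factorial M : ℝ)) ≤ 1 := by
  have h := halfBinom_le_choose (le_refl M)
  simpa using h

/-- The two-branch bound (geometric form) including the trivial point `w = 0`. -/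
theorem two_branch_geom_all (M : ℕ) (hM : 1 ≤ M) {w : ℂ} (hw1 : 1 + w ≠ 0) :
    ‖(∑ k ∈ Finset.range (M + 1), ((((descPochhammer ℝ k).eval ((M : ℝ) - 1 / 2) / (Nat.factorial k : ℝ)) : ℝ) : ℂ) * w ^ k) - (1 + w) ^ ((((M : ℝ) - 1 / 2) : ℝ) : ℂ)‖ ≤
      ‖1 + w‖ ^ (((M : ℝ) - 1 / 2)) * (((descPochhammer ℝ M).eval ((M : ℝ) - 1 / 2) / (Nat.factorial M : ℝ)) / 2 * (‖w‖ * (‖w‖ / (1 + ‖w‖)) ^ M)) +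
        ((descPochhammer ℝ M).eval ((M : ℝ) - 1 / 2) / (Nat.factorial M : ℝ)) / 2 * ‖w‖ ^ (M + 1) * ∫ β in (0 : ℝ)..|arg w|, ‖1 + ((‖w‖ : ℂ) * Complex.exp ((β : ℂ) * I))‖⁻¹ := by
  by_cases hw0 : w = 0
  · subst hw0
    have hT : (∑ k ∈ Finset.range (M + 1), ((((descPochhammer ℝ k).eval ((M : ℝ) - 1 / 2) / (Nat.factorial k : ℝ)) : ℝ) : ℂ) * (0 : ℂ) ^ k) = 1 :=
      truncBinom_zero M
    rw [hT]; simp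
  · exact norm_truncBinom_sub_cpow_le_geom M hM hw0 hw1

/-- Key inequality for the endpoint majorant: `|u − √A|·√A/u² ≤ |1 − A/u²|·√(A/u²)` (`u > 0`, `A ≥ 0`). -/
theorem endpoint_key_ineq {u A : ℝ} (hu : 0 < u) (hA : 0 ≤ A) :
    |u - Real.sqrt A| * Real.sqrt A / u ^ 2 ≤ |1 - A / u ^ 2| * Real.sqrt (A / u ^ 2) := by
  have hu2 : 0 < u ^ 2 := by positivity
  set s := Real.sqrt A with hsdef
  have hs0 : 0 ≤ s := Real.sqrt_nonneg _
  have hsA : s ^ 2 = A := Real.sq_sqrt hA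
  rw [Real.sqrt_div' _ hu2.le, Real.sqrt_sq hu.le, ← hsdef]
  have e1 : |1 - A / u ^ 2| = |u - s| * (u + s) / u ^ 2 := by
    rw [show 1 - A / u ^ 2 = ((u - s) * (u + s)) / u ^ 2 by rw [← hsA]; field_simp; ring, abs_div, abs_mul,
      abs_of_pos hu2, abs_of_nonneg (by linarith : 0 ≤ u + s)]
  rw [e1, div_mul_div_comm, div_le_div_iff₀ hu2 (by positivity)]
  have hus : u ≤ u + s := by linarith
  have h0 : 0 ≤ |u - s| * s * u ^ 2 := by positivity
  calc |u - s| * s * (u ^ 2 * u) = (|u - s| * s * u ^ 2) * u := by ring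
    _ ≤ (|u - s| * s * u ^ 2) * (u + s) := mul_le_mul_of_nonneg_left hus h0
    _ = |u - s| * (u + s) * s * u ^ 2 := by ring

/-- `√(|d|·√A/u²) = |d|^{1/2}·A^{1/4}/u` (`u > 0`, `A > 0`). -/
theorem sqrt_endpoint_eval {u A d : ℝ} (hu : 0 < u) (hA : 0 < A) (hd : 0 ≤ |d|) :
    Real.sqrt (|d| * Real.sqrt A / u ^ 2) = |d| ^ (1 / 2 : ℝ) * A ^ (1 / 4 : ℝ) / u := by
  have hu2 : 0 < u ^ 2 := by positivity
  rw [Real.sqrt_div' _ hu2.le, Real.sqrt_sq hu.le, Real.sqrt_eq_rpow, Real.mul_rpow hd (Real.sqrt_nonneg _),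
    Real.sqrt_eq_rpow, ← Real.rpow_mul hA.le]
  norm_num

set_option maxHeartbeats 400000 in
/-- **R2.** For `(2/5)υ ≤ u ≤ υ`, `‖a‖ ≤ 0.3502υ²`, and `u² ≠ ‖a‖` (off the single circle `|w| = 1`):
`Φu^{2M}‖T_M(a/u²)‖ ≤ 50e^{9υ}υ^{2M}‖1+a/υ²‖^N·((u²/υ² + 0.3502)/1.3502)^N + 0.225‖a‖^{M+1}u^{−2}
 + 0.71·‖a‖^{M}·‖a‖^{3/4}·u^{−1}·|u − √‖a‖|^{−1/2}`. -/
theorem junk_pointwise_R2 {M : ℕ} (hM : 1 ≤ M) {υ u : ℝ} {a : ℂ} (hυ : 0 < υ) (hlo : 2 / 5 * υ ≤ u) (huυ : u ≤ υ)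
    (ha : ‖a‖ ≤ 0.3502 * υ ^ 2) (hne : u ^ 2 ≠ ‖a‖) :
    deBruijnPhi u * u ^ (2 * M) *
        ‖∑ k ∈ Finset.range (M + 1),
          ((((descPochhammer ℝ k).eval ((M : ℝ) - 1 / 2) / (Nat.factorial k : ℝ) : ℝ)) : ℂ) * (a / (u : ℂ) ^ 2) ^ k‖ ≤
      50 * Real.exp (9 * υ) * υ ^ (2 * M) * ‖1 + a / (υ : ℂ) ^ 2‖ ^ ((M : ℝ) - 1 / 2) *
          ((u ^ 2 / υ ^ 2 + 0.3502) / 1.3502) ^ ((M : ℝ) - 1 / 2) +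
        0.225 * ‖a‖ ^ (M + 1) * u⁻¹ ^ 2 +
        0.71 * (‖a‖ ^ M * ‖a‖ ^ (3 / 4 : ℝ)) * (u⁻¹ * |u - Real.sqrt ‖a‖| ^ (-(1 / 2 : ℝ))) := by
  have hu : 0 < u := lt_of_lt_of_le (by positivity) hlo
  have hυ2 : 0 < υ ^ 2 := by positivity
  have hu2 : 0 < u ^ 2 := by positivity
  have hN0 : 0 ≤ (M : ℝ) - 1 / 2 := by
    have : (1:ℝ) ≤ M := by exact_mod_cast hM
    linarith
  have hΦ := deBruijnPhi_le_045_loc u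
  have hΦ0 := (deBruijnPhi_pos_of_nonneg hu.le).le
  have hC1 := halfBinom_top_le_one M
  have hC0 : 0 ≤ ((descPochhammer ℝ M).eval ((M : ℝ) - 1 / 2) / (Nat.factorial M : ℝ)) := (halfBinom_pos (le_refl M)).le
  set w : ℂ := a / (u : ℂ) ^ 2 with hwdef
  set r : ℝ := ‖w‖ with hrdef
  have hr : r = ‖a‖ / u ^ 2 := by
    rw [hrdef, hwdef, norm_div, norm_pow, Complex.norm_real, Real.norm_of_nonneg hu.le]
  have hr0 : 0 ≤ r := norm_nonneg _
  have hr1 : r ≠ 1 := by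
    intro h; apply hne; rw [hr, div_eq_one_iff_eq hu2.ne'] at h; exact h.symm
  -- `1 + w ≠ 0`
  have hw1 : 1 + w ≠ 0 := by
    intro h
    have : w = -1 := by linear_combination h
    apply hr1; rw [hrdef, this, norm_neg, norm_one]
  -- the two-branch bound
  have hTB := two_branch_geom_all M hM hw1
  rw [← hrdef] at hTB
  -- (i) ‖1 + w‖^N u^{2M} = u ‖u² + a‖^N and the bulk bound
  set q : ℝ := ‖1 + a / (υ : ℂ) ^ 2‖ with hqdef
  set x : ℝ := u ^ 2 / υ ^ 2 with hxdef
  have hx0 : 0.16 ≤ x := by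
    rw [hxdef, le_div_iff₀ hυ2]; nlinarith
  have hx1 : x ≤ 1 := by rw [hxdef, div_le_one hυ2]; nlinarith
  have hz : ‖a / (υ : ℂ) ^ 2‖ ≤ 0.3502 := by
    rw [norm_div, norm_pow, Complex.norm_real, Real.norm_of_nonneg hυ.le, div_le_iff₀ hυ2]; linarith
  have hρ : ‖(x : ℂ) + a / (υ : ℂ) ^ 2‖ ≤ q * ((x + 0.3502) / (1 + 0.3502)) :=
    norm_real_add_le_ratio_loc (by norm_num) (by nlinarith) hx1 hz
  have h1w : ‖1 + w‖ = ‖(x : ℂ) + a / (υ : ℂ) ^ 2‖ * (υ ^ 2 / u ^ 2) := by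
    have hu0 : (u : ℂ) ≠ 0 := by exact_mod_cast hu.ne'
    have hυ0 : (υ : ℂ) ≠ 0 := by exact_mod_cast hυ.ne'
    have : 1 + w = ((x : ℂ) + a / (υ : ℂ) ^ 2) * ((((υ ^ 2 / u ^ 2 : ℝ)) : ℂ)) := by
      rw [hwdef, hxdef]; push_cast; field_simp
    rw [this, norm_mul, Complex.norm_real, Real.norm_of_nonneg (by positivity)]
  -- bulk: u^{2M} ‖1+w‖^N ≤ υ^{2M} q^N ρ^N (times 1, using u ≤ υ)
  have hbulk : u ^ (2 * M) * ‖1 + w‖ ^ ((M : ℝ) - 1 / 2) ≤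
      υ ^ (2 * M) * q ^ ((M : ℝ) - 1 / 2) * ((x + 0.3502) / 1.3502) ^ ((M : ℝ) - 1 / 2) := by
    have hq0 : 0 ≤ q := norm_nonneg _
    have hρ0 : 0 ≤ (x + 0.3502) / 1.3502 := by positivity
    have hstep : ‖1 + w‖ ≤ (q * ((x + 0.3502) / 1.3502)) * (υ ^ 2 / u ^ 2) := by
      rw [h1w, show (1 + 0.3502 : ℝ) = 1.3502 by norm_num] at *
      exact mul_le_mul_of_nonneg_right hρ (by positivity)
    have hpow := Real.rpow_le_rpow (norm_nonneg _) hstep hN0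
    rw [Real.mul_rpow (by positivity) (by positivity), Real.mul_rpow hq0 hρ0] at hpow
    -- (υ²/u²)^N · u^{2M} = υ^{2M} · (u/υ)  ≤ υ^{2M}
    have hratio : u ^ (2 * M) * (υ ^ 2 / u ^ 2) ^ ((M : ℝ) - 1 / 2) = υ ^ (2 * M) * (u / υ) := by
      rw [Real.div_rpow hυ2.le hu2.le, sq_rpow_halfExp hM hυ.le, sq_rpow_halfExp hM hu.le]
      have e1 : u ^ (2 * M) = u * u ^ (2 * M - 1) := by rw [← pow_succ']; congr 1; omega
      have e2 : υ ^ (2 * M) = υ * υ ^ (2 * M - 1) := by rw [← pow_succ']; congr 1; omega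
      rw [e1, e2]
      have hune : u ^ (2 * M - 1) ≠ 0 := pow_ne_zero _ hu.ne'
      field_simp
    have huv : u / υ ≤ 1 := by rw [div_le_one hυ]; exact huυ
    calc u ^ (2 * M) * ‖1 + w‖ ^ ((M : ℝ) - 1 / 2)
        ≤ u ^ (2 * M) * (q ^ ((M : ℝ) - 1 / 2) * ((x + 0.3502) / 1.3502) ^ ((M : ℝ) - 1 / 2) *
            (υ ^ 2 / u ^ 2) ^ ((M : ℝ) - 1 / 2)) := mul_le_mul_of_nonneg_left hpow (by positivity)
      _ = (υ ^ (2 * M) * (u / υ)) * (q ^ ((M : ℝ) - 1 / 2) * ((x + 0.3502) / 1.3502) ^ ((M : ℝ) - 1 / 2)) := by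
          rw [← hratio]; ring
      _ ≤ (υ ^ (2 * M) * 1) * (q ^ ((M : ℝ) - 1 / 2) * ((x + 0.3502) / 1.3502) ^ ((M : ℝ) - 1 / 2)) := by
          gcongr
      _ = _ := by ring
  -- (ii) segment term: u^{2M} ‖1+w‖^N (C/2) r (r/(1+r))^M ≤ (C/2) ‖a‖^{M+1} u^{-2}
  have hseg : u ^ (2 * M) * (‖1 + w‖ ^ ((M : ℝ) - 1 / 2) *
      (((descPochhammer ℝ M).eval ((M : ℝ) - 1 / 2) / (Nat.factorial M : ℝ)) / 2 * (r * (r / (1 + r)) ^ M))) ≤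
      1 / 2 * ‖a‖ ^ (M + 1) * u⁻¹ ^ 2 := by
    -- ‖1+w‖ ≤ 1 + r and u^{2M}(1+r)^N (r/(1+r))^M r = u^{2M} r^{M+1} (1+r)^{N-M} ≤ u^{2M} r^{M+1} = ‖a‖^{M+1}/u²
    have h1r : ‖1 + w‖ ≤ 1 + r := by
      calc ‖1 + w‖ ≤ ‖(1:ℂ)‖ + ‖w‖ := norm_add_le _ _
        _ = 1 + r := by rw [norm_one]
    have hpowle : ‖1 + w‖ ^ ((M : ℝ) - 1 / 2) ≤ (1 + r) ^ ((M : ℝ) - 1 / 2) := Real.rpow_le_rpow (norm_nonneg _) h1r hN0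
    have h1r0 : 0 < 1 + r := by linarith
    have hsplit : (1 + r) ^ ((M : ℝ) - 1 / 2) * (r / (1 + r)) ^ M ≤ r ^ M := by
      rw [div_pow, show (1 + r) ^ ((M : ℝ) - 1 / 2) = (1 + r) ^ (M : ℝ) * (1 + r) ^ (-(1 / 2 : ℝ)) by
        rw [← Real.rpow_add h1r0]; ring_nf, Real.rpow_natCast]
      have hh : (1 + r) ^ (-(1 / 2 : ℝ)) ≤ 1 := Real.rpow_le_one_of_one_le_of_nonpos (by linarith) (by norm_num)
      have hne : (1 + r) ^ M ≠ 0 := pow_ne_zero _ h1r0.ne'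
      calc (1 + r) ^ M * (1 + r) ^ (-(1 / 2 : ℝ)) * (r ^ M / (1 + r) ^ M)
          = r ^ M * (1 + r) ^ (-(1 / 2 : ℝ)) := by field_simp
        _ ≤ r ^ M * 1 := mul_le_mul_of_nonneg_left hh (pow_nonneg hr0 _)
        _ = r ^ M := mul_one _
    have hrM : u ^ (2 * M) * r ^ (M + 1) = ‖a‖ ^ (M + 1) * u⁻¹ ^ 2 := by
      rw [hr, div_pow, inv_pow, pow_succ ‖a‖, pow_mul]
      have hune : (u ^ 2) ^ M ≠ 0 := pow_ne_zero _ hu2.ne'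
      field_simp
      ring
    calc u ^ (2 * M) * (‖1 + w‖ ^ ((M : ℝ) - 1 / 2) *
          (((descPochhammer ℝ M).eval ((M : ℝ) - 1 / 2) / (Nat.factorial M : ℝ)) / 2 * (r * (r / (1 + r)) ^ M)))
        = (((descPochhammer ℝ M).eval ((M : ℝ) - 1 / 2) / (Nat.factorial M : ℝ)) / 2) *
            (u ^ (2 * M) * r * (‖1 + w‖ ^ ((M : ℝ) - 1 / 2) * (r / (1 + r)) ^ M)) := by ring
      _ ≤ (1 / 2) * (u ^ (2 * M) * r * ((1 + r) ^ ((M : ℝ) - 1 / 2) * (r / (1 + r)) ^ M)) := by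
          apply mul_le_mul (by linarith) _ (by positivity) (by norm_num)
          apply mul_le_mul_of_nonneg_left _ (by positivity)
          exact mul_le_mul_of_nonneg_right hpowle (by positivity)
      _ ≤ (1 / 2) * (u ^ (2 * M) * r * r ^ M) := by gcongr
      _ = 1 / 2 * ‖a‖ ^ (M + 1) * u⁻¹ ^ 2 := by rw [mul_assoc (u ^ (2 * M)), ← pow_succ', hrM]; ring
  -- (iii) endpoint term: u^{2M} (C/2) r^{M+1} J ≤ (π/2) ‖a‖^{M+3/4} u^{-1} |u − √‖a‖|^{-1/2}
  have hend : u ^ (2 * M) * (((descPochhammer ℝ M).eval ((M : ℝ) - 1 / 2) / (Nat.factorial M : ℝ)) / 2 * r ^ (M + 1) *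
      ∫ β in (0 : ℝ)..|arg w|, ‖1 + ((r : ℂ) * Complex.exp ((β : ℂ) * I))‖⁻¹) ≤
      π / 2 * (‖a‖ ^ M * ‖a‖ ^ (3 / 4 : ℝ)) * (u⁻¹ * |u - Real.sqrt ‖a‖| ^ (-(1 / 2 : ℝ))) := by
    by_cases ha0 : a = 0
    · -- then r = 0 and the left side vanishes
      have : r = 0 := by rw [hr, ha0, norm_zero, zero_div]
      rw [this, ha0]
      simp
    have hapos : 0 < ‖a‖ := norm_pos_iff.mpr ha0
    have hrpos : 0 < r := by rw [hr]; positivity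
    have hJ := arcInv_integral_le_sqrt hrpos hr1 (abs_nonneg (arg w)) (Complex.abs_arg_le_pi w)
    -- √(|1−r|√r) in terms of u and ‖a‖:  |1 − r| √r = |u² − ‖a‖| ‖a‖^{1/2} / u³ ≥ |u − √‖a‖| ‖a‖^{1/2} / u²
    have hsa : Real.sqrt ‖a‖ ^ 2 = ‖a‖ := Real.sq_sqrt hapos.le
    have hsa0 : 0 ≤ Real.sqrt ‖a‖ := Real.sqrt_nonneg _
    have hkey : |u - Real.sqrt ‖a‖| * Real.sqrt ‖a‖ / u ^ 2 ≤ |1 - r| * Real.sqrt r := by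
      rw [hr]; exact endpoint_key_ineq hu (norm_nonneg a)
    -- hence J ≤ π / √(|u−√‖a‖| ‖a‖^{1/2}/u²) = π u |u−√‖a‖|^{-1/2} ‖a‖^{-1/4}
    by_cases hu0 : u = Real.sqrt ‖a‖
    · exfalso; apply hne; rw [hu0, hsa]
    have hd : 0 < |u - Real.sqrt ‖a‖| := abs_pos.mpr (sub_ne_zero.mpr hu0)
    have hL0 : 0 < |u - Real.sqrt ‖a‖| * Real.sqrt ‖a‖ / u ^ 2 := by positivity
    have hJ2 : (∫ β in (0 : ℝ)..|arg w|, ‖1 + ((r : ℂ) * Complex.exp ((β : ℂ) * I))‖⁻¹) ≤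
        π / Real.sqrt (|u - Real.sqrt ‖a‖| * Real.sqrt ‖a‖ / u ^ 2) := by
      refine hJ.trans ?_
      apply div_le_div_of_nonneg_left pi_pos.le (Real.sqrt_pos.mpr hL0)
      exact Real.sqrt_le_sqrt hkey
    -- evaluate the square root: √(|d| √‖a‖ / u²) = |d|^{1/2} ‖a‖^{1/4} / u
    have hsq : Real.sqrt (|u - Real.sqrt ‖a‖| * Real.sqrt ‖a‖ / u ^ 2) =
        |u - Real.sqrt ‖a‖| ^ (1 / 2 : ℝ) * ‖a‖ ^ (1 / 4 : ℝ) / u :=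
      sqrt_endpoint_eval hu hapos (abs_nonneg _)
    rw [hsq] at hJ2
    -- assemble
    have hI0 : 0 ≤ ∫ β in (0 : ℝ)..|arg w|, ‖1 + ((r : ℂ) * Complex.exp ((β : ℂ) * I))‖⁻¹ :=
      intervalIntegral.integral_nonneg (abs_nonneg _) fun β _ ↦ inv_nonneg.mpr (norm_nonneg _)
    have hrM : u ^ (2 * M) * r ^ (M + 1) = ‖a‖ ^ (M + 1) * u⁻¹ ^ 2 := by
      rw [hr, div_pow, inv_pow, pow_succ ‖a‖, pow_mul]
      have hune : (u ^ 2) ^ M ≠ 0 := pow_ne_zero _ hu2.ne'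
      field_simp
      ring
    have hd12 : 0 < |u - Real.sqrt ‖a‖| ^ (1 / 2 : ℝ) := Real.rpow_pos_of_pos hd _
    have ha14 : 0 < ‖a‖ ^ (1 / 4 : ℝ) := Real.rpow_pos_of_pos hapos _
    calc u ^ (2 * M) * (((descPochhammer ℝ M).eval ((M : ℝ) - 1 / 2) / (Nat.factorial M : ℝ)) / 2 * r ^ (M + 1) *
          ∫ β in (0 : ℝ)..|arg w|, ‖1 + ((r : ℂ) * Complex.exp ((β : ℂ) * I))‖⁻¹)
        = (((descPochhammer ℝ M).eval ((M : ℝ) - 1 / 2) / (Nat.factorial M : ℝ)) / 2) * (u ^ (2 * M) * r ^ (M + 1)) *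
            ∫ β in (0 : ℝ)..|arg w|, ‖1 + ((r : ℂ) * Complex.exp ((β : ℂ) * I))‖⁻¹ := by ring
      _ ≤ (1 / 2) * (‖a‖ ^ (M + 1) * u⁻¹ ^ 2) * (π / (|u - Real.sqrt ‖a‖| ^ (1 / 2 : ℝ) * ‖a‖ ^ (1 / 4 : ℝ) / u)) := by
          rw [hrM]
          apply mul_le_mul (mul_le_mul_of_nonneg_right (by linarith) (by positivity)) hJ2 hI0 (by positivity)
      _ = π / 2 * (‖a‖ ^ (M + 1) / ‖a‖ ^ (1 / 4 : ℝ)) * (u⁻¹ * (|u - Real.sqrt ‖a‖| ^ (1 / 2 : ℝ))⁻¹) := by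
          field_simp
      _ = π / 2 * (‖a‖ ^ M * ‖a‖ ^ (3 / 4 : ℝ)) * (u⁻¹ * |u - Real.sqrt ‖a‖| ^ (-(1 / 2 : ℝ))) := by
          congr 2
          · rw [div_eq_iff ha14.ne', pow_succ, mul_assoc, ← Real.rpow_add hapos]; norm_num
          · rw [Real.rpow_neg hd.le]
  -- final assembly
  have hπ : π / 2 ≤ 1.575 := by linarith [pi_lt_d2]
  have hI0 : 0 ≤ ∫ β in (0 : ℝ)..|arg w|, ‖1 + ((r : ℂ) * Complex.exp ((β : ℂ) * I))‖⁻¹ :=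
    intervalIntegral.integral_nonneg (abs_nonneg _) fun β _ ↦ inv_nonneg.mpr (norm_nonneg _)
  have hΦ50 : deBruijnPhi u ≤ 50 * Real.exp (9 * υ) := by
    have : (1:ℝ) ≤ Real.exp (9 * υ) := Real.one_le_exp (by positivity)
    linarith
  -- the norm of T is at most bulk + segment + endpoint
  have hT : ‖∑ k ∈ Finset.range (M + 1),
      ((((descPochhammer ℝ k).eval ((M : ℝ) - 1 / 2) / (Nat.factorial k : ℝ) : ℝ)) : ℂ) * (a / (u : ℂ) ^ 2) ^ k‖ ≤
      ‖1 + w‖ ^ ((M : ℝ) - 1 / 2) +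
        (‖1 + w‖ ^ (((M : ℝ) - 1 / 2)) * (((descPochhammer ℝ M).eval ((M : ℝ) - 1 / 2) / (Nat.factorial M : ℝ)) / 2 * (r * (r / (1 + r)) ^ M)) +
          ((descPochhammer ℝ M).eval ((M : ℝ) - 1 / 2) / (Nat.factorial M : ℝ)) / 2 * r ^ (M + 1) *
            ∫ β in (0 : ℝ)..|arg w|, ‖1 + ((r : ℂ) * Complex.exp ((β : ℂ) * I))‖⁻¹) := by
    rw [← hwdef]
    have h1 := norm_le_insert'
      (∑ k ∈ Finset.range (M + 1), ((((descPochhammer ℝ k).eval ((M : ℝ) - 1 / 2) / (Nat.factorial k : ℝ)) : ℝ) : ℂ) * w ^ k)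
      ((1 + w) ^ ((((M : ℝ) - 1 / 2) : ℝ) : ℂ))
    rw [Complex.norm_cpow_real] at h1
    linarith [h1, hTB]
  have T1 : deBruijnPhi u * (u ^ (2 * M) * ‖1 + w‖ ^ ((M : ℝ) - 1 / 2)) ≤
      50 * Real.exp (9 * υ) * (υ ^ (2 * M) * q ^ ((M : ℝ) - 1 / 2) * ((x + 0.3502) / 1.3502) ^ ((M : ℝ) - 1 / 2)) :=
    mul_le_mul hΦ50 hbulk (by positivity) (by positivity)
  have T2 : deBruijnPhi u * (u ^ (2 * M) * (‖1 + w‖ ^ (((M : ℝ) - 1 / 2)) *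
      (((descPochhammer ℝ M).eval ((M : ℝ) - 1 / 2) / (Nat.factorial M : ℝ)) / 2 * (r * (r / (1 + r)) ^ M)))) ≤
      0.45 * (1 / 2 * ‖a‖ ^ (M + 1) * u⁻¹ ^ 2) :=
    mul_le_mul hΦ hseg (by positivity) (by norm_num)
  have T3 : deBruijnPhi u * (u ^ (2 * M) * (((descPochhammer ℝ M).eval ((M : ℝ) - 1 / 2) / (Nat.factorial M : ℝ)) / 2 * r ^ (M + 1) *
      ∫ β in (0 : ℝ)..|arg w|, ‖1 + ((r : ℂ) * Complex.exp ((β : ℂ) * I))‖⁻¹)) ≤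
      0.45 * (π / 2 * (‖a‖ ^ M * ‖a‖ ^ (3 / 4 : ℝ)) * (u⁻¹ * |u - Real.sqrt ‖a‖| ^ (-(1 / 2 : ℝ)))) :=
    mul_le_mul hΦ hend (by positivity) (by norm_num)
  have h3 : 0 ≤ (‖a‖ ^ M * ‖a‖ ^ (3 / 4 : ℝ)) * (u⁻¹ * |u - Real.sqrt ‖a‖| ^ (-(1 / 2 : ℝ))) := by positivity
  have hmain := mul_le_mul_of_nonneg_left hT (mul_nonneg hΦ0 (pow_nonneg hu.le (2 * M)))
  rw [hxdef] at T1
  have hπ3 : 0.45 * (π / 2 * (‖a‖ ^ M * ‖a‖ ^ (3 / 4 : ℝ)) * (u⁻¹ * |u - Real.sqrt ‖a‖| ^ (-(1 / 2 : ℝ)))) ≤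
      0.71 * (‖a‖ ^ M * ‖a‖ ^ (3 / 4 : ℝ)) * (u⁻¹ * |u - Real.sqrt ‖a‖| ^ (-(1 / 2 : ℝ))) := by
    nlinarith only [h3, hπ]
  linarith [hmain, T1, T2, T3, hπ3]

end Summit.RiemannHypothesis.RiemannHypothesis.Theorems.JensenPolynomials.FarGumbel
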